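import Mathlib
import Literature.MathematicalPhysics.QuantumLattice.PairCorrelationsProofs
import Literature.MathematicalPhysics.QuantumLattice.LatticeToriLROProofs
import HarnessLib

/-!
# Even-side long-range order of the pair field from a column law

Topic `Literature/MathematicalPhysics/QuantumLattice`; companion of `PairCorrelationsProofs.lean`
(`pairFieldCorr_succ_le`, `norm_toLp_localPair_mulVec_le`, `hasTorusLRO_of_eventually_le`) and
`LatticeToriLROProofs.lean` (`sum_torusPullback_succ`). The summit `hubbard.S01` concludes
`HasLongRangeOrder` of the pull-back of `pairFieldCorr dWaveFormFactor ψ` over the fundamental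
domains `halfOpenBox 2 (2k)` of the EVEN sides only, for families of states constrained at even
sides only; routes reach it from lower bounds on the pair two-point function summed over columns
at a fixed relative displacement `r` along one cycle (`r̂ = min(r, L - r) ≥ R`). This file proves
the (elementary) bookkeeping, sorry-free:

* `sum_torusSite_two_reindex` — `Σ_{x,y ∈ (ℤ/Lℤ)²} F(x,y) = Σ_r Σ_{a,b,b'} F((a,b),(a+r,b'))`;
* `abs_re_expect_localPair_le` — the two-sided Cauchy–Schwarz bound `|re ⟨ψ, (P_x)ᴴ P_y ψ⟩| ≤ C_d²`
  for a normalised state (the tree had the upper bound `pairFieldCorr_succ_le`);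
* `exists_half_le_rpow_neg_div` — `L^{-C/L} ≥ 1/2` for all large `L`;
* `sum_pairCorr_ge_of_columnLaw` — a column law `A L³ r̂^{-C/L} ≤ Σ_{a,b,b'} re ⟨(P_{(a,b)})ᴴ
  P_{(a+r,b')}⟩` at the displacements `R' ≤ r̂` (`R' ≥ 1`) gives the volume-order bound
  `(A/8) L⁴ ≤ Σ_{x,y} re ⟨(P_x)ᴴ P_y⟩` once `L^{-C/L} ≥ 1/2` and `8R'(A + 2C_d²) ≤ A L`;
* `hasLongRangeOrder_even_of_le` — an eventual bound `a (n+1)⁴ ≤ Σ_{x,y} G_{n+1}(x,y)` at the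
  even sides `n + 1`, plus normalisation at even sides, gives `HasLongRangeOrder` along `k ↦ 2k`
  in the format of `hubbard.S01` (the a-priori bound `pairFieldCorr_succ_le` keeps Mathlib's real
  `liminf` off its junk value; odd sides are never looked at).

No definition and no named fact is introduced.

## Mathlib / tree search

`lean search 'sum_torusSite_two|columnLaw|hasLongRangeOrder_even'` found nothing (2026-08-16);
the all-sides analogue is `hasTorusLRO_of_eventually_le`, the subsequence argument for families
normalised at ALL sides is `Summits/…/Theorems/WeakCouplingBCSWcbcsThesis.lean`
(`liminf_comp_pos_of_le`). Mathlib: `Real.tendsto_pow_log_div_mul_add_atTop`,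
`Real.rpow_le_rpow_of_nonpos`, `Filter.le_liminf_of_le`, `Finset.card_le_card_of_injOn`.

## References

D. J. Scalapino, Phys. Rep. 250 (1995) 329, §2, eq. (2.4) (pair-field long-range order);
S. Friedli, Y. Velenik, *Statistical Mechanics of Lattice Systems* (2017), §3.7.2, Def. 3.27.
-/

noncomputable section

namespace Literature.MathematicalPhysics.QuantumLattice

open Matrix Finset Filter Literature.Probability.LatticeModels
open scoped _root_.Topology ComplexOrder

/-! ### Even-side long-range-order bookkeeping for the pair two-point function -/

section LRO

/-- Reindexing the double sum over the torus `(ℤ/Lℤ)²` by columns and the relative first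
coordinate: `Σ_{x,y} F(x,y) = Σ_r Σ_{a,b,b'} F((a,b),(a+r,b'))`. [folklore] -/
theorem sum_torusSite_two_reindex {M : Type*} [AddCommMonoid M] {L : ℕ} [NeZero L]
    (F : TorusSite 2 L → TorusSite 2 L → M) :
    ∑ x : TorusSite 2 L, ∑ y : TorusSite 2 L, F x y =
      ∑ r : ZMod L, ∑ a : ZMod L, ∑ b : ZMod L, ∑ b' : ZMod L, F ![a, b] ![a + r, b'] := by
  have hx : ∀ (G : TorusSite 2 L → M),
      ∑ x : TorusSite 2 L, G x = ∑ a : ZMod L, ∑ b : ZMod L, G ![a, b] := by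
    intro G
    have h1 : ∑ x : TorusSite 2 L, G x = ∑ p : ZMod L × ZMod L, G ![p.1, p.2] := by
      refine Fintype.sum_equiv (finTwoArrowEquiv (ZMod L)) _ _ fun x => ?_
      congr 1
      funext i; fin_cases i <;> rfl
    rw [h1, Fintype.sum_prod_type]
  rw [hx]
  simp_rw [hx (F _)]
  have hshift : ∀ (a b : ZMod L), ∑ a' : ZMod L, ∑ b' : ZMod L, F ![a, b] ![a', b'] =
      ∑ r : ZMod L, ∑ b' : ZMod L, F ![a, b] ![a + r, b'] := fun a b =>
    (Fintype.sum_equiv (Equiv.addLeft a) _ _ fun r => rfl).symm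
  simp_rw [hshift]
  calc ∑ a : ZMod L, ∑ b : ZMod L, ∑ r : ZMod L, ∑ b' : ZMod L, F ![a, b] ![a + r, b']
      = ∑ a : ZMod L, ∑ r : ZMod L, ∑ b : ZMod L, ∑ b' : ZMod L, F ![a, b] ![a + r, b'] :=
        Finset.sum_congr rfl fun a _ => Finset.sum_comm
    _ = ∑ r : ZMod L, ∑ a : ZMod L, ∑ b : ZMod L, ∑ b' : ZMod L, F ![a, b] ![a + r, b'] :=
        Finset.sum_comm

/-- **Two-sided Cauchy–Schwarz bound on one term of the pair two-point function** of a normalised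
state: `|re ⟨ψ, (P_x)ᴴ P_y ψ⟩| ≤ C_d²`, `C_d = Σ_{e ∈ {0} ∪ unitSteps} 2|g_d(e)|/√2` (cf. the
one-sided `pairFieldCorr_succ_le`). Scalapino, Phys. Rep. 250 (1995) 329, §2. [folklore] -/
theorem abs_re_expect_localPair_le {L : ℕ} [NeZero L] (ψ : Fock (Orb (FermionTorus 2 L)))
    (hψ : star ψ ⬝ᵥ ψ = 1) (x y : TorusSite 2 L) :
    |(expect ((localPair dWaveFormFactor L x)ᴴ * localPair dWaveFormFactor L y) ψ).re| ≤
      (∑ e ∈ insert (0 : Site 2) unitSteps,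
        ‖((dWaveFormFactor e / Real.sqrt 2 : ℝ) : ℂ)‖ * 2) ^ 2 := by
  rw [PosSemidefTrace.expect_conjTranspose_mul, star_dotProduct_eq_inner]
  have h1 : ‖(WithLp.toLp 2 ψ : EuclideanSpace ℂ (Finset (Orb (FermionTorus 2 L))))‖ = 1 := by
    have h := norm_toLp_sq_eq_re ψ
    rw [hψ, Complex.one_re] at h
    exact (pow_eq_one_iff_of_nonneg (norm_nonneg _) two_ne_zero).1 h
  refine (Complex.abs_re_le_norm _).trans ((norm_inner_le_norm _ _).trans ?_)
  rw [sq]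
  refine mul_le_mul ?_ ?_ (norm_nonneg _) (localPairNormBound_nonneg dWaveFormFactor)
  · simpa [h1] using norm_toLp_localPair_mulVec_le dWaveFormFactor L x ψ
  · simpa [h1] using norm_toLp_localPair_mulVec_le dWaveFormFactor L y ψ

/-- `L^{-C/L} ≥ 1/2` for all large `L` (because `C log L / L → 0`). [folklore] -/
theorem exists_half_le_rpow_neg_div (C : ℝ) :
    ∃ L₂ : ℕ, ∀ L : ℕ, L₂ ≤ L → (1 / 2 : ℝ) ≤ (L : ℝ) ^ (-(C / (L : ℝ))) := by
  have ht : Tendsto (fun x : ℝ => Real.log x ^ 1 / (1 * x + 0)) atTop (𝓝 0) :=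
    Real.tendsto_pow_log_div_mul_add_atTop 1 0 1 one_ne_zero
  have ht' : Tendsto (fun L : ℕ => C * (Real.log (L : ℝ) ^ 1 / (1 * (L : ℝ) + 0))) atTop
      (𝓝 (C * 0)) :=
    (ht.comp tendsto_natCast_atTop_atTop).const_mul C
  rw [mul_zero] at ht'
  have hev := ht'.eventually_le_const (Real.log_pos one_lt_two)
  obtain ⟨L₂, hL₂⟩ := Filter.eventually_atTop.1 hev
  refine ⟨max L₂ 1, fun L hL => ?_⟩
  have hL1 : 1 ≤ L := le_of_max_le_right hL
  have hLpos : (0 : ℝ) < (L : ℝ) := by exact_mod_cast hL1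
  have h := hL₂ L (le_of_max_le_left hL)
  simp only [pow_one, one_mul, add_zero] at h
  rw [Real.rpow_def_of_pos hLpos]
  have h2 : Real.log (L : ℝ) * -(C / (L : ℝ)) = -(C * (Real.log (L : ℝ) / (L : ℝ))) := by ring
  rw [h2, Real.exp_neg]
  have h3 : Real.exp (C * (Real.log (L : ℝ) / (L : ℝ))) ≤ 2 := by
    calc _ ≤ Real.exp (Real.log 2) := Real.exp_le_exp.2 h
      _ = 2 := Real.exp_log two_pos
  rw [one_div]
  exact inv_anti₀ (Real.exp_pos _) h3

/-- **Volume-order lower bound from a column law.** On the torus of side `L`, if for every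
displacement `r` with `R' ≤ r̂ = min(r, L - r)` (`R' ≥ 1`) the column-summed pair correlator obeys
`A L³ r̂^{-C/L} ≤ Σ_{a,b,b'} re ⟨ψ, (P_{(a,b)})ᴴ P_{(a+r,b')} ψ⟩`, and `L` is so large that
`L^{-C/L} ≥ 1/2` and `8 R'(A + 2C_d²) ≤ A L`, then `(A/8) L⁴ ≤ Σ_{x,y} re ⟨ψ, (P_x)ᴴ P_y ψ⟩`: the
`L - 2R'` good displacements contribute `≥ A L³/2` each (`r̂ ≤ L`, `r̂^{-C/L} ≥ L^{-C/L}`), the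
`≤ 2R'` short ones `≥ -L³ C_d²` each (Cauchy–Schwarz). Scalapino, Phys. Rep. 250 (1995) 329, §2,
eq. (2.4). [folklore] -/
theorem sum_pairCorr_ge_of_columnLaw {L : ℕ} [NeZero L] (ψ : Fock (Orb (FermionTorus 2 L)))
    (hψ : star ψ ⬝ᵥ ψ = 1) {A C : ℝ} (hA : 0 < A) (hC : 0 ≤ C) {R' : ℕ} (hR' : 1 ≤ R')
    (hcol : ∀ r : ZMod L, R' ≤ r.val → r.val + R' ≤ L →
      A * (L : ℝ) ^ 3 * ((min r.val (L - r.val) : ℕ) : ℝ) ^ (-(C / (L : ℝ))) ≤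
        ∑ a : ZMod L, ∑ b : ZMod L, ∑ b' : ZMod L,
          (expect ((localPair dWaveFormFactor L ![a, b])ᴴ *
            localPair dWaveFormFactor L ![a + r, b']) ψ).re)
    (hhalf : (1 / 2 : ℝ) ≤ (L : ℝ) ^ (-(C / (L : ℝ))))
    (hbig : 8 * (R' : ℝ) * (A + 2 * (∑ e ∈ insert (0 : Site 2) unitSteps,
        ‖((dWaveFormFactor e / Real.sqrt 2 : ℝ) : ℂ)‖ * 2) ^ 2) ≤ A * (L : ℝ)) :
    A / 8 * (L : ℝ) ^ 4 ≤ ∑ x : TorusSite 2 L, ∑ y : TorusSite 2 L,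
      (expect ((localPair dWaveFormFactor L x)ᴴ * localPair dWaveFormFactor L y) ψ).re := by
  classical
  set B : ℝ := (∑ e ∈ insert (0 : Site 2) unitSteps,
    ‖((dWaveFormFactor e / Real.sqrt 2 : ℝ) : ℂ)‖ * 2) ^ 2 with hB
  have hB0 : 0 ≤ B := by positivity
  set Lr : ℝ := (L : ℝ) with hLr
  have hLpos : 0 < Lr := by
    rw [hLr]; exact_mod_cast Nat.pos_of_ne_zero (NeZero.ne L)
  set F : TorusSite 2 L → TorusSite 2 L → ℝ := fun x y =>
    (expect ((localPair dWaveFormFactor L x)ᴴ * localPair dWaveFormFactor L y) ψ).re with hF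
  change A / 8 * Lr ^ 4 ≤ ∑ x : TorusSite 2 L, ∑ y : TorusSite 2 L, F x y
  rw [sum_torusSite_two_reindex F]
  set T : ZMod L → ℝ := fun r => ∑ a : ZMod L, ∑ b : ZMod L, ∑ b' : ZMod L,
    F ![a, b] ![a + r, b'] with hT
  change A / 8 * Lr ^ 4 ≤ ∑ r : ZMod L, T r
  -- per-term bounds
  have hFge : ∀ x y, -B ≤ F x y := fun x y =>
    (abs_le.1 (abs_re_expect_localPair_le ψ hψ x y)).1
  have hTbad : ∀ r, -(Lr ^ 3 * B) ≤ T r := by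
    intro r
    have h3 : -(Lr ^ 3 * B) = ∑ a : ZMod L, ∑ b : ZMod L, ∑ b' : ZMod L, (-B) := by
      simp only [Finset.sum_const, Finset.card_univ, ZMod.card]
      rw [hLr]; ring
    rw [h3]
    exact Finset.sum_le_sum fun a _ => Finset.sum_le_sum fun b _ => Finset.sum_le_sum
      fun b' _ => hFge _ _
  have hTgood : ∀ r : ZMod L, R' ≤ r.val ∧ r.val + R' ≤ L → A * Lr ^ 3 / 2 ≤ T r := by
    rintro r ⟨hr1, hr2⟩
    refine le_trans ?_ (hcol r hr1 hr2)
    have hmin1 : (1 : ℝ) ≤ ((min r.val (L - r.val) : ℕ) : ℝ) := by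
      have h1 : 1 ≤ r.val := le_trans hR' hr1
      have h2 : 1 ≤ L - r.val := by omega
      exact_mod_cast le_min h1 h2
    have hminL : ((min r.val (L - r.val) : ℕ) : ℝ) ≤ Lr := by
      rw [hLr]; exact_mod_cast (min_le_left _ _).trans (ZMod.val_lt r).le
    have hexp : -(C / Lr) ≤ 0 := by
      rw [neg_nonpos]; positivity
    have hpow : (1 / 2 : ℝ) ≤ ((min r.val (L - r.val) : ℕ) : ℝ) ^ (-(C / Lr)) :=
      hhalf.trans (Real.rpow_le_rpow_of_nonpos (by linarith) hminL hexp)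
    calc A * Lr ^ 3 / 2 = A * Lr ^ 3 * (1 / 2) := by ring
      _ ≤ A * Lr ^ 3 * ((min r.val (L - r.val) : ℕ) : ℝ) ^ (-(C / Lr)) := by gcongr
  -- counting the short displacements
  let good : ZMod L → Prop := fun r => R' ≤ r.val ∧ r.val + R' ≤ L
  have hcard_bad : ((Finset.univ.filter fun r => ¬ good r).card : ℝ) ≤ 2 * R' := by
    have hle : (Finset.univ.filter fun r => ¬ good r).card ≤
        (Finset.range R' ∪ Finset.Ioo (L - R') L).card := by
      refine Finset.card_le_card_of_injOn ZMod.val (fun r hr => ?_) ?_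
      · simp only [Finset.coe_filter, Finset.mem_univ, true_and, Set.mem_setOf_eq, good,
          not_and_or, not_le] at hr
        simp only [Finset.coe_union, Finset.coe_range, Finset.coe_Ioo, Set.mem_union,
          Set.mem_Iio, Set.mem_Ioo]
        by_cases hlt : r.val < R'
        · exact Or.inl hlt
        · have hr' : L < r.val + R' := by
            rcases hr with hr | hr
            · exact absurd hr hlt
            · exact hr
          exact Or.inr ⟨by omega, ZMod.val_lt r⟩
      · exact (ZMod.val_injective L).injOn
    have hle2 : (Finset.range R' ∪ Finset.Ioo (L - R') L).card ≤ 2 * R' := by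
      refine (Finset.card_union_le _ _).trans ?_
      rw [Finset.card_range, Nat.card_Ioo]
      omega
    exact_mod_cast hle.trans hle2
  have hcard_sum : ((Finset.univ.filter good).card : ℝ) +
      ((Finset.univ.filter fun r => ¬ good r).card : ℝ) = Lr := by
    have h := Finset.card_filter_add_card_filter_not (s := (Finset.univ : Finset (ZMod L))) good
    rw [Finset.card_univ, ZMod.card] at h
    rw [hLr]; exact_mod_cast h
  -- assemble
  rw [← Finset.sum_filter_add_sum_filter_not Finset.univ good T]
  have hg : ((Finset.univ.filter good).card : ℝ) * (A * Lr ^ 3 / 2) ≤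
      ∑ r ∈ Finset.univ.filter good, T r := by
    have h := Finset.card_nsmul_le_sum (Finset.univ.filter good) T (A * Lr ^ 3 / 2)
      (fun r hr => hTgood r (by simpa [good] using hr))
    rwa [nsmul_eq_mul] at h
  have hb : ((Finset.univ.filter fun r => ¬ good r).card : ℝ) * (-(Lr ^ 3 * B)) ≤
      ∑ r ∈ Finset.univ.filter (fun r => ¬ good r), T r := by
    have h := Finset.card_nsmul_le_sum (Finset.univ.filter fun r => ¬ good r) T (-(Lr ^ 3 * B))
      (fun r _ => hTbad r)
    rwa [nsmul_eq_mul] at h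
  set g : ℝ := ((Finset.univ.filter good).card : ℝ) with hg'
  set b : ℝ := ((Finset.univ.filter fun r => ¬ good r).card : ℝ) with hb'
  have hgX : g * (A * Lr ^ 3 / 2) = Lr * (A * Lr ^ 3 / 2) - b * (A * Lr ^ 3 / 2) := by
    rw [← hcard_sum]; ring
  have hXY0 : 0 ≤ A * Lr ^ 3 / 2 + Lr ^ 3 * B := by positivity
  have hbXY : b * (A * Lr ^ 3 / 2 + Lr ^ 3 * B) ≤ 2 * (R' : ℝ) * (A * Lr ^ 3 / 2 + Lr ^ 3 * B) :=
    mul_le_mul_of_nonneg_right hcard_bad hXY0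
  have hR3 : (R' : ℝ) * Lr ^ 3 * (A + 2 * B) ≤ A * Lr ^ 4 / 8 := by
    have h := mul_le_mul_of_nonneg_right hbig (show (0 : ℝ) ≤ Lr ^ 3 / 8 by positivity)
    calc (R' : ℝ) * Lr ^ 3 * (A + 2 * B) = 8 * (R' : ℝ) * (A + 2 * B) * (Lr ^ 3 / 8) := by ring
      _ ≤ A * Lr * (Lr ^ 3 / 8) := h
      _ = A * Lr ^ 4 / 8 := by ring
  have hA4 : 0 ≤ A * Lr ^ 4 := by positivity
  linarith [hg, hb, hgX, hbXY, hR3, hA4]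

/-- **Long-range order along the even sides from an eventual volume-order lower bound.** If a
family of torus states `ψ_L` is normalised at every EVEN side `n + 1` and, for all large even
`n + 1`, `a (n+1)⁴ ≤ Σ_{x,y} G_{n+1}(x,y)` with `a > 0` (`G` the pair two-point function
`pairFieldCorr g ψ`), then `HasLongRangeOrder` holds along the sides `2k` for the pull-back to `ℤ²`
over the fundamental domains `halfOpenBox 2 (2k)` — the conclusion format of `hubbard.S01`. The
a-priori bound `pairFieldCorr_succ_le` keeps Mathlib's real `liminf` off its junk value; the odd
sides are never looked at. Friedli–Velenik (2017), §3.7.2, Definition 3.27. [folklore] -/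
theorem hasLongRangeOrder_even_of_le (g : Site 2 → ℝ) (ψ : ∀ L, Fock (Orb (FermionTorus 2 L)))
    (hnorm : ∀ n : ℕ, Even (n + 1) → star (ψ (n + 1)) ⬝ᵥ ψ (n + 1) = 1) {a : ℝ} (ha : 0 < a)
    (K : ℕ) (hlow : ∀ n : ℕ, Even (n + 1) → K ≤ n + 1 →
      a * ((n + 1 : ℕ) : ℝ) ^ 4 ≤
        ∑ x : TorusSite 2 (n + 1), ∑ y : TorusSite 2 (n + 1), pairFieldCorr g ψ (n + 1) x y) :
    HasLongRangeOrder (fun k => halfOpenBox 2 (2 * k))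
      (fun k => torusPullback (pairFieldCorr g ψ) (2 * k)) := by
  set B : ℝ := (∑ e ∈ insert (0 : Site 2) unitSteps, ‖((g e / Real.sqrt 2 : ℝ) : ℂ)‖ * 2) ^ 2
    with hB
  have hB0 : 0 ≤ B := by positivity
  set u : ℕ → ℝ := fun L => (∑ x ∈ halfOpenBox 2 L, ∑ y ∈ halfOpenBox 2 L,
      torusPullback (pairFieldCorr g ψ) L x y) / ((halfOpenBox 2 L).card : ℝ) ^ 2 with hu
  change 0 < liminf (fun k : ℕ => u (2 * k)) atTop
  have hup : ∀ k, u (2 * k) ≤ B := by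
    intro k
    cases k with
    | zero =>
      have h0 : ((halfOpenBox 2 (2 * 0)).card : ℝ) ^ 2 = 0 := by rw [card_halfOpenBox]; simp
      simp only [hu]
      rw [h0, div_zero]
      exact hB0
    | succ k =>
      obtain ⟨n, hn⟩ : ∃ n, 2 * (k + 1) = n + 1 := ⟨2 * k + 1, by ring⟩
      have heven : star (ψ (n + 1)) ⬝ᵥ ψ (n + 1) = 1 := hnorm n ⟨k + 1, by omega⟩
      rw [hn]
      simp only [hu]
      rw [sum_torusPullback_succ, div_le_iff₀ (by positivity)]
      calc ∑ x : TorusSite 2 (n + 1), ∑ y, pairFieldCorr g ψ (n + 1) x y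
          ≤ ∑ x : TorusSite 2 (n + 1), ∑ y : TorusSite 2 (n + 1), B :=
            Finset.sum_le_sum fun x _ => Finset.sum_le_sum fun y _ =>
              pairFieldCorr_succ_le g ψ n heven x y
        _ = B * ((n + 1 : ℕ) : ℝ) ^ (2 * 2) := by
            simp only [Finset.sum_const, Finset.card_univ, Fintype.card_pi, ZMod.card,
              Finset.prod_const, Fintype.card_fin]
            push_cast
            ring
  have hev : ∀ᶠ k : ℕ in atTop, a ≤ u (2 * k) := by
    rw [Filter.eventually_atTop]
    refine ⟨max K 1, fun k hk => ?_⟩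
    obtain ⟨n, hn⟩ : ∃ n, 2 * k = n + 1 := ⟨2 * k - 1, by have := le_of_max_le_right hk; omega⟩
    have h := hlow n ⟨k, by omega⟩ (by have := le_of_max_le_left hk; omega)
    rw [hn]
    simp only [hu]
    rw [sum_torusPullback_succ, le_div_iff₀ (by positivity)]
    simpa [pow_mul] using h
  refine lt_of_lt_of_le ha (le_liminf_of_le ?_ hev)
  exact isCoboundedUnder_ge_of_eventually_le _ (Eventually.of_forall hup)

end LRO

end Literature.MathematicalPhysics.QuantumLattice

end
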